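import Mathlib.Analysis.SpecialFunctions.Gamma.Beta
import Mathlib.Analysis.SpecialFunctions.Sigmoid
import Mathlib.MeasureTheory.Function.JacobianOneDim
import Literature.Analysis.FunctionSpaces.BesselK
import Literature.Analysis.Complex.DeBruijnUniversalFactorsProofs
import HarnessLib

/-!
# The Mellin transform of `e^{-y} K_ν(y)`: `∫₀^∞ y^{μ-1} e^{-y} K_ν(y) dy = √π Γ(μ+ν)Γ(μ-ν) / (2^μ Γ(μ+½))`

Sibling proof file of `BesselK.lean` / `BesselKMellin.lean` / `BesselKPolya.lean` (one auxiliary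
definition, `mellinBesselKernel`, the two-variable integrand; otherwise theorems only). The classical
Mellin transform of `e^{-y} K_ν(y)` (Gradshteyn–Ryzhik 6.621.3; Watson §13.21), in the form and for
the purpose it appears in the spectral theory of Kloosterman sums: the unfolding of a Poincaré
series against a Maass cusp form,
`⟨P_m(·, s), ψ_j⟩ = (2πm)^{1/2-s} ρ̄_j(m) ∫₀^∞ y^{s-3/2} e^{-y} K_{iκ_j}(y) dy
 = √π (4πm)^{1/2-s} ρ̄_j(m) Γ(s-1/2+iκ_j) Γ(s-1/2-iκ_j) / Γ(s)`
(Motohashi, *Spectral theory of the Riemann zeta-function*, (2.1.18); the case `μ = s - 1/2`,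
`ν = iκ_j` of the theorem below). Everything is PROVED:

1. (§1) **the logistic substitution** `x = σ(t) = (1 + e^{-t})⁻¹` (Mathlib's `Real.sigmoid`):
   `B(u, v) = ∫_ℝ σ(t)^u σ(-t)^v dt` for ALL `u, v ∈ ℂ` (`betaIntegral_eq_integral_sigmoid`, by
   `integral_image_eq_integral_abs_deriv_smul`; `dx = σ(t)σ(-t)dt`, `1 - σ(t) = σ(-t)`), with the
   transfer of integrability (`integrable_sigmoid_cpow_mul`, `Re u, Re v > 0`), and the pointwise
   identity `e^{νt}(1/(1 + cosh t))^μ = 2^μ σ(t)^{μ+ν} σ(-t)^{μ-ν}` (`1 + cosh t = (2σ(t)σ(-t))⁻¹`,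
   `e^t = σ(t)/σ(-t)`);
2. (§2) **the `cosh`-moment** `∫₀^∞ cosh(νt)(1/(1 + cosh t))^μ dt = 2^{μ-1} B(μ+ν, μ-ν)` for
   `Re μ > |Re ν|` (`integral_cosh_mul_one_div_one_add_cosh_cpow`; symmetrisation `t ↦ -t`);
3. (§3) **the theorem** `integral_cpow_mul_exp_neg_mul_besselK`: for `Re μ > |Re ν|`,
   `∫₀^∞ y^{μ-1} e^{-y} K_ν(y) dy = √π Γ(μ+ν)Γ(μ-ν) / (2^μ Γ(μ+1/2))` — insert
   `K_ν(y) = ∫₀^∞ e^{-y cosh t} cosh(νt) dt` (`besselK`), Fubini on `(0,∞)²`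
   (`integrable_mellinBesselKernel`: `e^{-y cosh t} ≤ C (y cosh t)^{-a'}` with `|Re ν| < a' < Re μ`
   gives a product majorant), the inner Gamma integral `∫₀^∞ y^{μ-1} e^{-(1+cosh t)y} dy =
   Γ(μ)(1 + cosh t)^{-μ}`, §2, `Γ(u)Γ(v) = Γ(u+v)B(u,v)` and Legendre's duplication formula.

## References
* [Motohashi1997] Y. Motohashi, *Spectral Theory of the Riemann Zeta-Function*, Cambridge Tracts
  in Math. 127, CUP 1997, §2.1, (2.1.18), PDF p. 41 (held copy
  `book:motohashi1997-spectral-theory-riemann-zeta-function`, chunk p0041).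
* I. S. Gradshteyn, I. M. Ryzhik, *Table of Integrals, Series, and Products*, 6.621.3;
  G. N. Watson, *A Treatise on the Theory of Bessel Functions*, §13.21 (the general
  `∫₀^∞ e^{-at} K_ν(bt) t^{μ-1} dt`).
* [BatemanGrosswald1964] for the definition of `K_ν` used (`BesselK.lean`).

Mathlib: `Complex.betaIntegral`, `Complex.betaIntegral_convergent`, `Complex.Gamma_mul_Gamma_eq_betaIntegral`,
`Complex.Gamma_mul_Gamma_add_half`, `Complex.integral_cpow_mul_exp_neg_mul_Ioi`, `Real.GammaIntegral_convergent`,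
`Real.sigmoid` (`hasDerivAt_sigmoid`, `range_sigmoid`, `sigmoid_neg`), `integral_image_eq_integral_abs_deriv_smul`,
`integrableOn_image_iff_integrableOn_abs_deriv_smul`, `integral_integral_swap`, `Integrable.mul_prod`,
`Measure.prod_restrict`, `integral_comp_neg_Ioi`, `intervalIntegral.integral_Iic_add_Ioi`,
`exp_neg_integrableOn_Ioi`, `Complex.norm_cpow_eq_rpow_re_of_pos`, `Real.log_le_sub_one_of_pos`.
Literature: `besselK`, `besselKIntegrand`, `besselK_def` (`BesselK.lean`); `DeBruijn1950.cosh_le_exp_abs`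
(`DeBruijnUniversalFactorsProofs.lean`). Two three-line folklore lemmas have near-duplicates in other
areas of the tree (`ofReal_cpow_eq_exp_log` ~ `…LongRangePhi4.Kato.cpow_ofReal_pos` in
`Barriers/CriticalPhenomena`, `norm_cosh_le_cosh_re` ~ `Barriers.RiemannHypothesis.norm_ccosh_le_cosh_re`
in `EpsteinZetaBatemanGrosswaldProofs.lean`); they are re-proved here rather than importing those
heavy cross-area files into `Analysis/FunctionSpaces`. Tree search
(`lean search 'besselK.*Gamma|Mellin.*besselK|integral.*besselK'`): only the other Mellin-type
integral `∫₀^∞ u^{ν-1} e^{-x(u/c+c/u)/2} du = 2c^ν K_ν(x)` (`BesselKMellin.lean`) is in the tree.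
-/

noncomputable section

namespace Literature.Analysis.FunctionSpaces

open MeasureTheory Set Real _root_.Complex Filter
open scoped Topology

/-! ## 1. The logistic substitution: `∫_ℝ σ(t)^u σ(-t)^v dt = B(u, v)` -/

section Logistic

/-- `σ(t) σ(-t) · 2 (1 + cosh t) = 1`: the identity `(1 + e^t)(1 + e^{-t}) = 2(1 + cosh t)`. [folklore] -/
theorem two_mul_sigmoid_mul_sigmoid_neg (t : ℝ) :
    2 * Real.sigmoid t * Real.sigmoid (-t) = 1 / (1 + Real.cosh t) := by
  rw [Real.sigmoid_def, Real.sigmoid_def, neg_neg, Real.cosh_eq]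
  have h1 : 0 < 1 + Real.exp (-t) := by positivity
  have h2 : 0 < 1 + Real.exp t := by positivity
  have h3 : Real.exp t * Real.exp (-t) = 1 := by rw [← Real.exp_add, add_neg_cancel, Real.exp_zero]
  field_simp
  nlinarith [h3]

/-- `σ(t) / σ(-t) = e^t`. [folklore] -/
theorem sigmoid_div_sigmoid_neg (t : ℝ) : Real.sigmoid t / Real.sigmoid (-t) = Real.exp t := by
  rw [Real.sigmoid_def, Real.sigmoid_def, neg_neg]
  have h1 : 0 < 1 + Real.exp (-t) := by positivity
  have h2 : 0 < 1 + Real.exp t := by positivity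
  have h3 : Real.exp t * Real.exp (-t) = 1 := by rw [← Real.exp_add, add_neg_cancel, Real.exp_zero]
  field_simp
  nlinarith [h3, Real.exp_pos t, Real.exp_pos (-t)]

/-- A positive real to a complex power, through the real logarithm: `x^s = exp(s log x)`. [folklore] -/
theorem ofReal_cpow_eq_exp_log {x : ℝ} (hx : 0 < x) (s : ℂ) :
    (x : ℂ) ^ s = Complex.exp (s * (Real.log x : ℂ)) := by
  rw [cpow_def_of_ne_zero (ofReal_ne_zero.mpr hx.ne'), ← Complex.ofReal_log hx.le, mul_comm]

/-- **The integrand identity**: for real `t`,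
`e^{νt} (1/(1 + cosh t))^μ = 2^μ σ(t)^{μ+ν} σ(-t)^{μ-ν}` (`σ` the logistic function). [folklore] -/
theorem exp_mul_one_div_one_add_cosh_cpow (μ ν : ℂ) (t : ℝ) :
    Complex.exp (ν * t) * ((1 / (1 + Real.cosh t) : ℝ) : ℂ) ^ μ =
      (2 : ℂ) ^ μ * ((Real.sigmoid t : ℂ) ^ (μ + ν) * (Real.sigmoid (-t) : ℂ) ^ (μ - ν)) := by
  have hs1 : 0 < Real.sigmoid t := Real.sigmoid_pos t
  have hs2 : 0 < Real.sigmoid (-t) := Real.sigmoid_pos (-t)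
  have hc : 0 < 1 / (1 + Real.cosh t) := by have := Real.cosh_pos t; positivity
  rw [ofReal_cpow_eq_exp_log hc, ofReal_cpow_eq_exp_log hs1, ofReal_cpow_eq_exp_log hs2,
    show (2 : ℂ) = ((2 : ℝ) : ℂ) by norm_num, ofReal_cpow_eq_exp_log (by norm_num : (0 : ℝ) < 2)]
  rw [← Complex.exp_add, ← Complex.exp_add, ← Complex.exp_add]
  congr 1
  -- the two real logarithmic identities
  have hL1 : Real.log (1 / (1 + Real.cosh t)) =
      Real.log 2 + Real.log (Real.sigmoid t) + Real.log (Real.sigmoid (-t)) := by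
    rw [← two_mul_sigmoid_mul_sigmoid_neg, Real.log_mul (by positivity) hs2.ne',
      Real.log_mul (by norm_num) hs1.ne']
  have hL2 : (t : ℝ) = Real.log (Real.sigmoid t) - Real.log (Real.sigmoid (-t)) := by
    rw [← Real.log_div hs1.ne' hs2.ne', sigmoid_div_sigmoid_neg, Real.log_exp]
  have hL1' : (Real.log (1 / (1 + Real.cosh t)) : ℂ) =
      (Real.log 2 : ℂ) + (Real.log (Real.sigmoid t) : ℂ) + (Real.log (Real.sigmoid (-t)) : ℂ) := by
    exact_mod_cast hL1
  have hL2' : (t : ℂ) = (Real.log (Real.sigmoid t) : ℂ) - (Real.log (Real.sigmoid (-t)) : ℂ) := by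
    exact_mod_cast hL2
  rw [hL1', hL2']
  ring

/-- **The logistic substitution**: for all complex `u, v`,
`B(u, v) = ∫_ℝ σ(t)^u σ(-t)^v dt` (`x = σ(t) = (1 + e^{-t})⁻¹`, `dx = σ(t)σ(-t) dt`,
`1 - σ(t) = σ(-t)`; both sides are `0` when the integrals diverge). [folklore] -/
theorem betaIntegral_eq_integral_sigmoid (u v : ℂ) :
    Complex.betaIntegral u v =
      ∫ t : ℝ, (Real.sigmoid t : ℂ) ^ u * (Real.sigmoid (-t) : ℂ) ^ v := by
  have hcv := integral_image_eq_integral_abs_deriv_smul (s := Set.univ) (f := Real.sigmoid)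
    (f' := fun x => Real.sigmoid x * (1 - Real.sigmoid x)) MeasurableSet.univ
    (fun x _ => (Real.hasDerivAt_sigmoid x).hasDerivWithinAt) (Real.sigmoid_injective.injOn)
    (fun x : ℝ => (x : ℂ) ^ (u - 1) * (1 - (x : ℂ)) ^ (v - 1))
  rw [Set.image_univ, Real.range_sigmoid, Measure.restrict_univ] at hcv
  rw [Complex.betaIntegral, intervalIntegral.integral_of_le zero_le_one, integral_Ioc_eq_integral_Ioo, hcv]
  refine integral_congr_ae (Eventually.of_forall fun t => ?_)
  have hs1 : 0 < Real.sigmoid t := Real.sigmoid_pos t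
  have hs2 : 0 < Real.sigmoid (-t) := Real.sigmoid_pos (-t)
  have h1s : (1 : ℂ) - (Real.sigmoid t : ℂ) = (Real.sigmoid (-t) : ℂ) := by
    rw [Real.sigmoid_neg]; push_cast; ring
  simp only
  rw [abs_of_pos (mul_pos hs1 (by linarith [Real.sigmoid_lt_one t])), h1s, Complex.real_smul]
  have hne1 : (Real.sigmoid t : ℂ) ≠ 0 := ofReal_ne_zero.mpr hs1.ne'
  have hne2 : (Real.sigmoid (-t) : ℂ) ≠ 0 := ofReal_ne_zero.mpr hs2.ne'
  have e1 : (Real.sigmoid t : ℂ) ^ u = (Real.sigmoid t : ℂ) * (Real.sigmoid t : ℂ) ^ (u - 1) := by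
    rw [cpow_sub _ _ hne1, cpow_one]; field_simp
  have e2 : (Real.sigmoid (-t) : ℂ) ^ v = (Real.sigmoid (-t) : ℂ) * (Real.sigmoid (-t) : ℂ) ^ (v - 1) := by
    rw [cpow_sub _ _ hne2, cpow_one]; field_simp
  rw [e1, e2]
  push_cast
  rw [h1s]
  ring

/-- Integrability transfers along the substitution: if `Re u, Re v > 0` then
`t ↦ σ(t)^u σ(-t)^v` is integrable on `ℝ`. [folklore] -/
theorem integrable_sigmoid_cpow_mul {u v : ℂ} (hu : 0 < u.re) (hv : 0 < v.re) :
    Integrable fun t : ℝ => (Real.sigmoid t : ℂ) ^ u * (Real.sigmoid (-t) : ℂ) ^ v := by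
  have hint : IntegrableOn (fun x : ℝ => (x : ℂ) ^ (u - 1) * (1 - (x : ℂ)) ^ (v - 1)) (Ioo 0 1) := by
    have h := (Complex.betaIntegral_convergent hu hv).1
    -- `IntervalIntegrable` gives integrability on `Ioc 0 1 ⊇ Ioo 0 1`
    exact h.mono_set Ioo_subset_Ioc_self
  have hcv := (integrableOn_image_iff_integrableOn_abs_deriv_smul (s := Set.univ) (f := Real.sigmoid)
    (f' := fun x => Real.sigmoid x * (1 - Real.sigmoid x)) MeasurableSet.univ
    (fun x _ => (Real.hasDerivAt_sigmoid x).hasDerivWithinAt) (Real.sigmoid_injective.injOn)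
    (fun x : ℝ => (x : ℂ) ^ (u - 1) * (1 - (x : ℂ)) ^ (v - 1))).1
  rw [Set.image_univ, Real.range_sigmoid] at hcv
  have h := hcv hint
  rw [integrableOn_univ] at h
  refine (integrable_congr (Eventually.of_forall fun t => ?_)).mp h
  have hs1 : 0 < Real.sigmoid t := Real.sigmoid_pos t
  have hs2 : 0 < Real.sigmoid (-t) := Real.sigmoid_pos (-t)
  have h1s : (1 : ℂ) - (Real.sigmoid t : ℂ) = (Real.sigmoid (-t) : ℂ) := by
    rw [Real.sigmoid_neg]; push_cast; ring
  rw [abs_of_pos (mul_pos hs1 (by linarith [Real.sigmoid_lt_one t])), h1s, Complex.real_smul]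
  have hne1 : (Real.sigmoid t : ℂ) ≠ 0 := ofReal_ne_zero.mpr hs1.ne'
  have hne2 : (Real.sigmoid (-t) : ℂ) ≠ 0 := ofReal_ne_zero.mpr hs2.ne'
  have e1 : (Real.sigmoid t : ℂ) ^ u = (Real.sigmoid t : ℂ) * (Real.sigmoid t : ℂ) ^ (u - 1) := by
    rw [cpow_sub _ _ hne1, cpow_one]; field_simp
  have e2 : (Real.sigmoid (-t) : ℂ) ^ v = (Real.sigmoid (-t) : ℂ) * (Real.sigmoid (-t) : ℂ) ^ (v - 1) := by
    rw [cpow_sub _ _ hne2, cpow_one]; field_simp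
  rw [e1, e2]
  push_cast
  rw [h1s]
  ring

end Logistic

/-! ## 2. The `t`-integral: `∫₀^∞ cosh(νt) (1 + cosh t)^{-μ} dt = 2^{μ-1} B(μ+ν, μ-ν)` -/

section CoshIntegral

/-- `(1/(1 + cosh t))^μ` is even in `t`. [folklore] -/
theorem one_div_one_add_cosh_neg (t : ℝ) : 1 / (1 + Real.cosh (-t)) = 1 / (1 + Real.cosh t) := by
  rw [Real.cosh_neg]

/-- The symmetrised integrand `F(t) = e^{νt}(1/(1 + cosh t))^μ` is integrable on `ℝ` when
`Re μ > |Re ν|` (through the logistic substitution and the convergence of `B(μ+ν, μ-ν)`). [folklore] -/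
theorem integrable_exp_mul_one_div_one_add_cosh_cpow {μ ν : ℂ} (h : |ν.re| < μ.re) :
    Integrable fun t : ℝ => Complex.exp (ν * t) * ((1 / (1 + Real.cosh t) : ℝ) : ℂ) ^ μ := by
  have hu : 0 < (μ + ν).re := by rw [add_re]; have := neg_abs_le ν.re; linarith
  have hv : 0 < (μ - ν).re := by rw [sub_re]; have := le_abs_self ν.re; linarith
  have hi := (integrable_sigmoid_cpow_mul hu hv).const_mul ((2 : ℂ) ^ μ)
  refine (integrable_congr (Eventually.of_forall fun t => ?_)).mp hi
  exact (exp_mul_one_div_one_add_cosh_cpow μ ν t).symm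

/-- `∫_ℝ e^{νt} (1/(1 + cosh t))^μ dt = 2^μ B(μ+ν, μ-ν)`. [folklore] -/
theorem integral_exp_mul_one_div_one_add_cosh_cpow (μ ν : ℂ) :
    ∫ t : ℝ, Complex.exp (ν * t) * ((1 / (1 + Real.cosh t) : ℝ) : ℂ) ^ μ =
      (2 : ℂ) ^ μ * Complex.betaIntegral (μ + ν) (μ - ν) := by
  rw [betaIntegral_eq_integral_sigmoid, ← MeasureTheory.integral_const_mul]
  exact integral_congr_ae (Eventually.of_forall fun t => exp_mul_one_div_one_add_cosh_cpow μ ν t)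

/-- **The `cosh`-moment of `(1 + cosh t)^{-μ}`**: for `Re μ > |Re ν|`,
`∫₀^∞ cosh(νt) (1/(1 + cosh t))^μ dt = 2^{μ-1} B(μ+ν, μ-ν) (= 2^{μ-1} Γ(μ+ν)Γ(μ-ν)/Γ(2μ))`. [folklore] -/
theorem integral_cosh_mul_one_div_one_add_cosh_cpow {μ ν : ℂ} (h : |ν.re| < μ.re) :
    ∫ t in Ioi (0 : ℝ), Complex.cosh (ν * t) * ((1 / (1 + Real.cosh t) : ℝ) : ℂ) ^ μ =
      (2 : ℂ) ^ (μ - 1) * Complex.betaIntegral (μ + ν) (μ - ν) := by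
  set F : ℝ → ℂ := fun t => Complex.exp (ν * t) * ((1 / (1 + Real.cosh t) : ℝ) : ℂ) ^ μ with hF
  have hFi : Integrable F := integrable_exp_mul_one_div_one_add_cosh_cpow h
  have hFneg : ∀ t : ℝ, F (-t) = Complex.exp (-(ν * t)) * ((1 / (1 + Real.cosh t) : ℝ) : ℂ) ^ μ := by
    intro t
    simp only [hF, one_div_one_add_cosh_neg]
    push_cast
    ring_nf
  -- `cosh(νt) W(t) = (F t + F(-t))/2`
  have hsplit : ∀ t : ℝ, Complex.cosh (ν * t) * ((1 / (1 + Real.cosh t) : ℝ) : ℂ) ^ μ =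
      (1 / 2 : ℂ) * (F t + F (-t)) := by
    intro t
    rw [hFneg t, Complex.cosh]
    simp only [hF]
    ring
  simp_rw [hsplit]
  rw [MeasureTheory.integral_const_mul,
    integral_add hFi.integrableOn (hFi.comp_neg.integrableOn), integral_comp_neg_Ioi 0 F, neg_zero,
    add_comm, intervalIntegral.integral_Iic_add_Ioi hFi.integrableOn hFi.integrableOn,
    integral_exp_mul_one_div_one_add_cosh_cpow]
  have h2 : (2 : ℂ) ^ (μ - 1) = (2 : ℂ) ^ μ / 2 := by
    rw [cpow_sub _ _ two_ne_zero, cpow_one]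
  rw [h2]
  ring

end CoshIntegral

/-! ## 3. The Mellin transform of `e^{-y} K_ν(y)` -/

section Mellin

/-- `‖cosh w‖ ≤ cosh (Re w)`. [folklore] -/
theorem norm_cosh_le_cosh_re (w : ℂ) : ‖Complex.cosh w‖ ≤ Real.cosh w.re := by
  rw [Complex.cosh, Real.cosh_eq]
  calc ‖(Complex.exp w + Complex.exp (-w)) / 2‖ = ‖Complex.exp w + Complex.exp (-w)‖ / 2 := by
        rw [norm_div, Complex.norm_two]
    _ ≤ (‖Complex.exp w‖ + ‖Complex.exp (-w)‖) / 2 := by gcongr; exact norm_add_le _ _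
    _ = (Real.exp w.re + Real.exp (-w.re)) / 2 := by rw [Complex.norm_exp, Complex.norm_exp, neg_re]

/-- `x^a e^{-x} ≤ a^a e^{-a}` for `x, a > 0` (the maximum of `x^a e^{-x}` is at `x = a`). [folklore] -/
theorem rpow_mul_exp_neg_le {a x : ℝ} (ha : 0 < a) (hx : 0 < x) :
    x ^ a * Real.exp (-x) ≤ a ^ a * Real.exp (-a) := by
  -- `log (x/a) ≤ x/a - 1`
  have h1 := Real.log_le_sub_one_of_pos (div_pos hx ha)
  rw [Real.log_div hx.ne' ha.ne'] at h1
  have h2 : a * Real.log x - x ≤ a * Real.log a - a := by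
    have h3 : a * (Real.log x - Real.log a) ≤ a * (x / a - 1) := mul_le_mul_of_nonneg_left h1 ha.le
    have h4 : a * (x / a - 1) = x - a := by field_simp
    linarith
  have e1 : x ^ a * Real.exp (-x) = Real.exp (a * Real.log x - x) := by
    rw [Real.rpow_def_of_pos hx, ← Real.exp_add]; ring_nf
  have e2 : a ^ a * Real.exp (-a) = Real.exp (a * Real.log a - a) := by
    rw [Real.rpow_def_of_pos ha, ← Real.exp_add]; ring_nf
  rw [e1, e2]
  exact Real.exp_le_exp.mpr h2

/-- `e^{-x} ≤ a^a e^{-a} x^{-a}` for `x, a > 0`. [folklore] -/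
theorem exp_neg_le_mul_rpow_neg {a x : ℝ} (ha : 0 < a) (hx : 0 < x) :
    Real.exp (-x) ≤ a ^ a * Real.exp (-a) * x ^ (-a) := by
  have h := rpow_mul_exp_neg_le ha hx
  have hxa : 0 < x ^ a := Real.rpow_pos_of_pos hx a
  rw [Real.rpow_neg hx.le, le_mul_inv_iff₀ hxa, mul_comm]
  exact h

/-- `cosh(t)^{-a} ≤ 2^a e^{-a t}` for `a ≥ 0` (`cosh t ≥ e^t/2`). [folklore] -/
theorem cosh_rpow_neg_le {a : ℝ} (ha : 0 ≤ a) (t : ℝ) :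
    Real.cosh t ^ (-a) ≤ (2 : ℝ) ^ a * Real.exp (-a * t) := by
  have hc : 0 < Real.cosh t := Real.cosh_pos t
  have he : 0 < Real.exp t / 2 := by positivity
  have hle : Real.exp t / 2 ≤ Real.cosh t := by
    rw [Real.cosh_eq]; linarith [Real.exp_pos (-t)]
  calc Real.cosh t ^ (-a) ≤ (Real.exp t / 2) ^ (-a) :=
        Real.rpow_le_rpow_of_nonpos he hle (by linarith)
    _ = (2 : ℝ) ^ a * Real.exp (-a * t) := by
        rw [Real.div_rpow (Real.exp_pos t).le zero_le_two, Real.rpow_neg (Real.exp_pos t).le,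
          Real.rpow_neg zero_le_two, ← Real.exp_mul, show t * a = -(-a * t) by ring, Real.exp_neg]
        field_simp

variable {μ ν : ℂ}

/-- The two-variable kernel `G(y, t) = y^{μ-1} e^{-y} · e^{-y cosh t} cosh(νt)`. [folklore] -/
def mellinBesselKernel (μ ν : ℂ) (y t : ℝ) : ℂ :=
  (y : ℂ) ^ (μ - 1) * Complex.exp (-(y : ℂ)) * besselKIntegrand ν y t

/-- Pointwise: `G(y, t) = cosh(νt) · (y^{μ-1} e^{-(1 + cosh t) y})`. [folklore] -/
theorem mellinBesselKernel_eq (μ ν : ℂ) (y t : ℝ) :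
    mellinBesselKernel μ ν y t =
      Complex.cosh (ν * t) * ((y : ℂ) ^ (μ - 1) * Complex.exp (-((1 + Real.cosh t : ℝ) * y))) := by
  rw [mellinBesselKernel, besselKIntegrand]
  have he : Complex.exp (-(y : ℂ)) * Complex.exp (-(y : ℂ) * (Real.cosh t : ℂ)) =
      Complex.exp (-((1 + Real.cosh t : ℝ) * y)) := by
    rw [← Complex.exp_add]; congr 1; push_cast; ring
  rw [← he]
  ring

/-- The norm of the kernel: `‖G(y, t)‖ = y^{Re μ - 1} e^{-y} e^{-y cosh t} ‖cosh(νt)‖` (`y > 0`). [folklore] -/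
theorem norm_mellinBesselKernel {y : ℝ} (hy : 0 < y) (t : ℝ) :
    ‖mellinBesselKernel μ ν y t‖ =
      y ^ (μ.re - 1) * Real.exp (-y) * Real.exp (-(y * Real.cosh t)) * ‖Complex.cosh (ν * t)‖ := by
  rw [mellinBesselKernel, besselKIntegrand, norm_mul, norm_mul, norm_mul,
    Complex.norm_cpow_eq_rpow_re_of_pos hy, sub_re, one_re]
  have e1 : ‖Complex.exp (-(y : ℂ))‖ = Real.exp (-y) := by
    rw [Complex.norm_exp]; simp
  have e2 : ‖Complex.exp (-(y : ℂ) * (Real.cosh t : ℂ))‖ = Real.exp (-(y * Real.cosh t)) := by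
    rw [Complex.norm_exp]
    congr 1
    simp [Complex.mul_re]
  rw [e1, e2]
  ring

/-- **Integrability of the kernel on `(0,∞)²`** for `Re μ > |Re ν|`: with `a = Re μ`, `b = |Re ν|`,
`a' = (a+b)/2`, `e^{-y cosh t} ≤ C (y cosh t)^{-a'}` splits `‖G‖` into the product majorant
`C · (y^{a-a'-1} e^{-y}) · (2^{a'} e^{-(a'-b)t})` of two integrable functions. [folklore] -/
theorem integrable_mellinBesselKernel (h : |ν.re| < μ.re) :
    Integrable (Function.uncurry (mellinBesselKernel μ ν))
      ((volume.restrict (Ioi (0 : ℝ))).prod (volume.restrict (Ioi (0 : ℝ)))) := by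
  set a : ℝ := μ.re with ha_def
  set b : ℝ := |ν.re| with hb_def
  set a' : ℝ := (a + b) / 2 with ha'_def
  have hb0 : 0 ≤ b := abs_nonneg _
  have ha'pos : 0 < a' := by rw [ha'_def]; linarith
  have h1 : 0 < a - a' := by rw [ha'_def]; linarith
  have h2 : 0 < a' - b := by rw [ha'_def]; linarith
  set C : ℝ := a' ^ a' * Real.exp (-a') with hC
  have hC0 : 0 ≤ C := by positivity
  -- the majorant
  set g : ℝ × ℝ → ℝ := fun p => C * ((Real.exp (-p.1) * p.1 ^ (a - a' - 1)) *
    ((2 : ℝ) ^ a' * Real.exp (-(a' - b) * p.2))) with hg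
  have hgi : Integrable g ((volume.restrict (Ioi (0 : ℝ))).prod (volume.restrict (Ioi (0 : ℝ)))) := by
    have i1 : Integrable (fun y : ℝ => Real.exp (-y) * y ^ (a - a' - 1)) (volume.restrict (Ioi 0)) :=
      Real.GammaIntegral_convergent h1
    have i2 : Integrable (fun t : ℝ => (2 : ℝ) ^ a' * Real.exp (-(a' - b) * t)) (volume.restrict (Ioi 0)) :=
      (exp_neg_integrableOn_Ioi 0 h2).const_mul _
    exact (i1.mul_prod i2).const_mul C
  -- measurability
  have hmeas : AEStronglyMeasurable (Function.uncurry (mellinBesselKernel μ ν))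
      ((volume.restrict (Ioi (0 : ℝ))).prod (volume.restrict (Ioi (0 : ℝ)))) := by
    rw [Measure.prod_restrict]
    refine ContinuousOn.aestronglyMeasurable ?_ (measurableSet_Ioi.prod measurableSet_Ioi)
    intro p hp
    have hp1 : 0 < p.1 := hp.1
    unfold Function.uncurry mellinBesselKernel besselKIntegrand
    refine ContinuousAt.continuousWithinAt ?_
    apply ContinuousAt.mul
    · apply ContinuousAt.mul
      · exact (Complex.continuousAt_ofReal_cpow_const p.1 (μ - 1) (Or.inr hp1.ne')).comp continuousAt_fst
      · exact (Complex.continuous_exp.comp (Complex.continuous_ofReal.comp continuous_fst).neg).continuousAt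
    · exact ((Complex.continuous_exp.comp (((Complex.continuous_ofReal.comp continuous_fst).neg).mul
        (Complex.continuous_ofReal.comp (Real.continuous_cosh.comp continuous_snd)))).mul
        (Complex.continuous_cosh.comp (continuous_const.mul (Complex.continuous_ofReal.comp continuous_snd)))).continuousAt
  refine hgi.mono' hmeas ?_
  rw [Measure.prod_restrict]
  refine (ae_restrict_mem (measurableSet_Ioi.prod measurableSet_Ioi)).mono fun p hp => ?_
  obtain ⟨hy, ht⟩ := hp
  simp only [mem_Ioi] at hy ht
  set y : ℝ := p.1
  set t : ℝ := p.2
  show ‖mellinBesselKernel μ ν y t‖ ≤ g (y, t)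
  rw [norm_mellinBesselKernel hy, hg]
  simp only
  -- the four factors
  have f4 : ‖Complex.cosh (ν * t)‖ ≤ Real.exp (b * t) := by
    refine (norm_cosh_le_cosh_re _).trans ?_
    refine (Literature.Analysis.Complex.DeBruijn1950.cosh_le_exp_abs _).trans ?_
    apply Real.exp_le_exp.mpr
    have : (ν * (t : ℂ)).re = ν.re * t := by simp [Complex.mul_re]
    rw [this, abs_mul, abs_of_pos ht]
  have hx : 0 < y * Real.cosh t := mul_pos hy (Real.cosh_pos t)
  have f3 : Real.exp (-(y * Real.cosh t)) ≤ C * (y ^ (-a') * ((2 : ℝ) ^ a' * Real.exp (-a' * t))) := by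
    refine (exp_neg_le_mul_rpow_neg ha'pos hx).trans ?_
    rw [← hC, Real.mul_rpow hy.le (Real.cosh_pos t).le]
    have := cosh_rpow_neg_le ha'pos.le t
    have hy' : 0 ≤ y ^ (-a') := Real.rpow_nonneg hy.le _
    calc C * (y ^ (-a') * Real.cosh t ^ (-a')) ≤ C * (y ^ (-a') * ((2 : ℝ) ^ a' * Real.exp (-a' * t))) := by
          gcongr
      _ = _ := rfl
  have hya : y ^ (a - 1) * y ^ (-a') = y ^ (a - a' - 1) := by
    rw [← Real.rpow_add hy]; ring_nf
  calc y ^ (a - 1) * Real.exp (-y) * Real.exp (-(y * Real.cosh t)) * ‖Complex.cosh (ν * t)‖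
      ≤ y ^ (a - 1) * Real.exp (-y) * (C * (y ^ (-a') * ((2 : ℝ) ^ a' * Real.exp (-a' * t)))) *
          Real.exp (b * t) := by gcongr
    _ = C * (Real.exp (-y) * (y ^ (a - 1) * y ^ (-a')) * ((2 : ℝ) ^ a' * (Real.exp (-a' * t) * Real.exp (b * t)))) := by
          ring
    _ = C * (Real.exp (-y) * y ^ (a - a' - 1) * ((2 : ℝ) ^ a' * Real.exp (-(a' - b) * t))) := by
          rw [hya, ← Real.exp_add]; ring_nf

/-- The inner integral: `∫₀^∞ G(y, t) dy = cosh(νt) Γ(μ) (1/(1 + cosh t))^μ` (`Re μ > 0`). [folklore] -/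
theorem integral_mellinBesselKernel_left (hμ : 0 < μ.re) (t : ℝ) :
    ∫ y in Ioi (0 : ℝ), mellinBesselKernel μ ν y t =
      Complex.cosh (ν * t) * (((1 / (1 + Real.cosh t) : ℝ) : ℂ) ^ μ * Complex.Gamma μ) := by
  have hr : 0 < 1 + Real.cosh t := by have := Real.cosh_pos t; linarith
  simp_rw [mellinBesselKernel_eq]
  rw [MeasureTheory.integral_const_mul, Complex.integral_cpow_mul_exp_neg_mul_Ioi hμ hr]
  congr 2
  push_cast
  ring

/-- **The Mellin transform of `e^{-y} K_ν(y)`.** For `Re μ > |Re ν|`,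
`∫₀^∞ y^{μ-1} e^{-y} K_ν(y) dy = √π Γ(μ+ν) Γ(μ-ν) / (2^μ Γ(μ+1/2))`
(insert `K_ν(y) = ∫₀^∞ e^{-y cosh t} cosh(νt) dt`, integrate in `y` first, evaluate the
`cosh`-moment by the logistic substitution and use `Γ(μ)Γ(μ+1/2) = 2^{1-2μ}√π Γ(2μ)`). With
`μ = s - 1/2`, `ν = iκ` this is the constant in `⟨P_m(·, s), ψ_j⟩ = (2πm)^{1/2-s} ρ̄_j(m) ∫₀^∞ y^{s-3/2} e^{-y} K_{iκ_j}(y) dy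
= √π (4πm)^{1/2-s} ρ̄_j(m) Γ(s-1/2+iκ_j)Γ(s-1/2-iκ_j)/Γ(s)` (Motohashi (2.1.18)).
[cite: Motohashi1997, (2.1.18), PDF p. 41] -/
theorem integral_cpow_mul_exp_neg_mul_besselK (h : |ν.re| < μ.re) :
    ∫ y in Ioi (0 : ℝ), (y : ℂ) ^ (μ - 1) * Complex.exp (-(y : ℂ)) * besselK ν y =
      (Real.sqrt π : ℂ) * Complex.Gamma (μ + ν) * Complex.Gamma (μ - ν) /
        ((2 : ℂ) ^ μ * Complex.Gamma (μ + 1 / 2)) := by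
  have hμ : 0 < μ.re := lt_of_le_of_lt (abs_nonneg _) h
  have hu : 0 < (μ + ν).re := by rw [add_re]; have := neg_abs_le ν.re; linarith
  have hv : 0 < (μ - ν).re := by rw [sub_re]; have := le_abs_self ν.re; linarith
  -- Step 1: the integrand as an inner integral of the kernel
  have step1 : ∫ y in Ioi (0 : ℝ), (y : ℂ) ^ (μ - 1) * Complex.exp (-(y : ℂ)) * besselK ν y =
      ∫ y in Ioi (0 : ℝ), ∫ t in Ioi (0 : ℝ), mellinBesselKernel μ ν y t := by
    refine setIntegral_congr_fun measurableSet_Ioi fun y _ => ?_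
    rw [besselK_def, ← MeasureTheory.integral_const_mul]
    rfl
  -- Step 2: Fubini
  have step2 : (∫ y in Ioi (0 : ℝ), ∫ t in Ioi (0 : ℝ), mellinBesselKernel μ ν y t) =
      ∫ t in Ioi (0 : ℝ), ∫ y in Ioi (0 : ℝ), mellinBesselKernel μ ν y t :=
    integral_integral_swap (integrable_mellinBesselKernel h)
  -- Step 3: the inner integral and the cosh-moment
  have step3 : (∫ t in Ioi (0 : ℝ), ∫ y in Ioi (0 : ℝ), mellinBesselKernel μ ν y t) =
      Complex.Gamma μ * ((2 : ℂ) ^ (μ - 1) * Complex.betaIntegral (μ + ν) (μ - ν)) := by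
    simp_rw [integral_mellinBesselKernel_left hμ]
    rw [← integral_cosh_mul_one_div_one_add_cosh_cpow h, ← MeasureTheory.integral_const_mul]
    exact integral_congr_ae (Eventually.of_forall fun t => by ring)
  rw [step1, step2, step3]
  -- Step 4: Gamma-function algebra
  have hB := Complex.Gamma_mul_Gamma_eq_betaIntegral hu hv
  rw [show μ + ν + (μ - ν) = 2 * μ by ring] at hB
  have hdup := Complex.Gamma_mul_Gamma_add_half μ
  have hGh : Complex.Gamma (μ + 1 / 2) ≠ 0 :=
    Complex.Gamma_ne_zero_of_re_pos (by rw [add_re]; norm_num; linarith)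
  have h2μ : (2 : ℂ) ^ μ ≠ 0 := Complex.cpow_ne_zero_iff.mpr (Or.inl two_ne_zero)
  have hpow : (2 : ℂ) ^ (1 - 2 * μ) * (2 : ℂ) ^ (μ - 1) * (2 : ℂ) ^ μ = 1 := by
    rw [← cpow_add _ _ two_ne_zero, ← cpow_add _ _ two_ne_zero,
      show (1 - 2 * μ + (μ - 1) + μ) = (0 : ℂ) by ring, cpow_zero]
  rw [eq_div_iff (mul_ne_zero h2μ hGh), mul_assoc (Real.sqrt π : ℂ), hB]
  calc Complex.Gamma μ * ((2 : ℂ) ^ (μ - 1) * Complex.betaIntegral (μ + ν) (μ - ν)) *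
        ((2 : ℂ) ^ μ * Complex.Gamma (μ + 1 / 2))
      = (Complex.Gamma μ * Complex.Gamma (μ + 1 / 2)) * ((2 : ℂ) ^ (μ - 1) * (2 : ℂ) ^ μ) *
          Complex.betaIntegral (μ + ν) (μ - ν) := by ring
    _ = Complex.Gamma (2 * μ) * (2 : ℂ) ^ (1 - 2 * μ) * (Real.sqrt π : ℂ) * ((2 : ℂ) ^ (μ - 1) * (2 : ℂ) ^ μ) *
          Complex.betaIntegral (μ + ν) (μ - ν) := by rw [hdup]
    _ = (Real.sqrt π : ℂ) * (Complex.Gamma (2 * μ) * Complex.betaIntegral (μ + ν) (μ - ν)) *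
          ((2 : ℂ) ^ (1 - 2 * μ) * (2 : ℂ) ^ (μ - 1) * (2 : ℂ) ^ μ) := by ring
    _ = (Real.sqrt π : ℂ) * (Complex.Gamma (2 * μ) * Complex.betaIntegral (μ + ν) (μ - ν)) := by
          rw [hpow, mul_one]

end Mellin

end Literature.Analysis.FunctionSpaces
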